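import Literature.AlgebraicGeometry.HodgeTheory.WeilClassesCyclicPrymAllGenera
import Literature.AlgebraicGeometry.HodgeTheory.WeilClassesCMReductionHyperbolic
import HarnessLib

/-!
# Weil classes on Schoen's primitive Prym `4n`-folds of cyclic ÉTALE covers of degree `12` — the
# `m = 12` slice (`K = ℚ(μ₁₂) = ℚ(i, √3)`, a QUARTIC CM field), all genera; its genus-`4` member is a
# `ℚ(ζ₁₂)`-Weil TWELVEFOLD of the biquadratic cell `(d, m) = (1, 3)`

Family `hodge`, layer `Literature/AlgebraicGeometry/HodgeTheory`. One file for ONE source section — the same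
section as `WeilClassesCyclicPrymAllGenera` (C. Schoen, Compositio Math. 65 (1988) 3–32 [`Schoen1988HodgeWeil`,
REFEREED], §2 Thm. 2.0 with §3 Cor. 3.1 in the unramified case `r = 0`; D. Patel, Y. Zhang, J. Algebra 712 (2027)
= arXiv:2506.13729 [`PatelZhang2025PrymHodge`, REFEREED], Thm. 1.2, §5 Lemma 5.1, §5.1, Thm. 5.3) — at the FIRST
degree for which the cyclotomic field is NOT imaginary quadratic but still small: `m = 12`, `φ(12) = 4`,
`K = ℚ(μ₁₂) = ℚ(ζ₁₂) = ℚ(i, √3)`, totally real subfield `F = ℚ(√3)`. The sibling file's module docstring wrote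
that "the general-`m` form, `φ(m) > 2`, still waits for the `χ`-isotypic decomposition of `H¹`"; for the purpose of
STATING Schoen's theorem no such decomposition is needed any more: the tree's Moonen–Zarhin carrier
`HodgeTheory.weilClassesField B θ P r = ⊕_{P(ρ)=0} ⋀ʳ H¹(B)_ρ ⊗ ℂ` (`WeilClassesMoonenZarhinCriterion`) IS
`U_prim ⊗ ℂ = (⋀ʳ_K H¹(B_prim, ℚ)) ⊗ ℂ` for ANY generator `θ` of `K ⊂ End⁰(B_prim)` with minimal polynomial `P`
(Moonen–Zarhin 1998, §1: "`W_F ⊗ ℂ = ⊕_{σ ∈ Σ_F} ⋀ʳ_ℂ V_{ℂ,σ}`", `V_{ℂ,σ}` the subspace where `F` acts through `σ` — a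
datum of the FIELD `F = K`, not of the generator). Nothing in this file says or implies that the Hodge conjecture,
or the Hodge conjecture for abelian varieties, or anything about a GENERAL member of a Weil component, is proved.

## Sources, verbatim (held texts; read at this seat 2026-08-28)

Patel–Zhang (held arXiv text `paper:arxiv-2506.13729`, chunk `pNNNN`):
> (§5, p0012 L15–22) "**Lemma 5.1.** The Prym variety `B` satisfies the following properties. `B` has dimension
> `(m-1)(g(C')-1)`. The generator `σ` above induces an automrphism of `B` of order `m`. The tangent space at the
> identity `T₀B` has a natural induced action of `ℤ/mℤ` for which each eigenvalue `exp(2πki/m)` with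
> `1 ≤ k ≤ m-1` occurs with multiplicity `g(C')-1`." (p0012 L24) "When `m` is not prime, `B` is reducible, and
> Schoen's Prym variety [Schoen88] is an irreducible factor of `B`."
> (§5.1, p0012 L29–42) "**Definition 5.2.** … we call a character `χ` primitive if `χ : G → ℂ^*` is injective.
> … Schoen's Prym variety is `J(C)_{V_prim}` associated with the irreducible rational `G`-representation `V_prim`
> whose complexification consists of all the primitive characters. … The cohomology `H¹(B_prim, ℚ)` is a vector
> space over `ℚ(μ_m)`, and the tangent space at origin … decomposes as a direct sum of eigenspaces corresponding
> to the primitive characters, with each character appearing with multiplicity `h/2`. `End_ℚ(B_prim) ⊇ ℚ(μ_m)`.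
> … `U_prim := ⋀^h_{ℚ(μ_m)} H¹(B_prim, ℚ) ⊆ H^h(B_prim, ℚ)` consists of Hodge classes …
> **Theorem 5.3 (Schoen88).** `U_prim` is generated by algebraic cycles."
> (§1.3, p0004 L2) "When `m = 3` (resp. `4`), these give rise to Weil abelian fourfolds with CM field `ℚ(μ₃)`
> (resp. `ℚ(i)`) with trivial discriminant."

Schoen 1988 (Numdam scan, materialised at this seat as `paper:url-39676669fef8`, scan page `p00NN` = printed
page `NN + 1`):
> (§3, Cor. 3.1, printed p. 24) "If `(C, σ)` satisfies the hypotheses of (2.0), then `U' ⊂ H^h(B, ℚ)` is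
> generated by fundamental classes of codimension `h/2` algebraic cycles." (Thm. 2.0, p. 11; p. 12: the
> simplicity hypothesis "is automatically satisfied if `r = 0`".)
> (printed pp. 25–26 = p0024 L28–p0025 L12, the MODULI COUNT) "Suppose that `A` is a complex, polarized, abelian
> variety with a `ℤ/m`-action such that `H⁰(A, Ω¹_A)` becomes a free `𝒪(μ_m) ⊗ ℂ` module of rank `h/2`. The
> cotangent space to the space of those deformations of `A` to which the polarization and the group action lift
> … has dimension `(φ(m)/2)(h/2)²`. … the number of moduli for pairs `(C, σ)` is `3q - 3 + 2r`. … the general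
> abelian variety in this family will not be dominated by the Jacobian of one of our curves, `C`, unless
> `3/2 ≥ h φ(m)/8`."

So at `(m, h) = (12, 6)` (genus-`4` base, `r = 0`): the `ℚ(ζ₁₂)`-Weil family has `(4/2)·3² = 18` moduli, the
cyclic-Prym locus `3·4 - 3 = 9` — a HALF-DIMENSIONAL ALGEBRAIC ANCHOR LOCUS inside the family, every member of
which has ALL its `K`-Weil classes algebraic by Cor. 3.1; it is NOT a general member.

## Rendering (the siblings' rendering; only `m`, the genus and the Weil generator change)

`g(C') = n + 1` with `n ≥ 1` (`h = 2n`); an étale cyclic cover `C → C'` of degree `12` by a connected curve has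
`g(C) = 12n + 1` (Riemann–Hurwitz). As in the siblings: `C : SchemeOver ℂ` smooth projective of dimension `1`
with a Jacobian `𝒥` (`Motives.Jacobian`) of dimension `12n + 1`, an automorphism `α` with `α¹² = 𝟙` whose
powers `α⁴` (order `3`) and `α⁶` (order `2`) have no fixed complex point — so `⟨α⟩ ≅ ℤ/12` acts FREELY (an
element of `ℤ/12` with a fixed point has a power of prime order with a fixed point) —, `s := α_*`
(`Jacobian.pushforward`), `Φ := Φ₁₂(s) = 𝟙 - s² + s⁴` (a separate binder with its defining equation, as `e_N`
in `…_degreeSeven`), `B := (ker Φ)⁰` (`AbelianVariety.kerComponent`) — which IS Schoen's `B_prim = J(C)_{V_prim}`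
(`Φ₁₂` vanishes exactly at the primitive `12`-th roots of unity among the `12`-th roots of unity; `dim B =
φ(12)·h/2·½·2 = 4n`) —, `s_B` the restriction of `s` to `B` (`kerComponentRestrict`; `Φ₁₂(s_B) = 0`,
`kerComponent_cyclotomic₁₂_restrict_eq_zero`). WEIL GENERATOR: `η := -𝟙 + 2 s_B² + s_B³`. On an eigenline where
`s_B` acts as `ζ = e^{2πik/12}`, `k ∈ {1, 5, 7, 11}`, `η` acts as `-1 + 2ζ² + ζ³ ∈ {± i(1 + √3), ± i(1 - √3)}`
(at `k = 1`: `2ζ² - 1 = i√3`, `ζ³ = i`), the four roots of `P₁₂(T) := T⁴ + 8T² + 4 = R₁₂(T²)`,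
`R₁₂(S) := S² + 8S + 4` (roots `-4 ∓ 2√3 = -(1 ± √3)²`, real negative); `η` generates `K = ℚ(ζ₁₂)` (`η` has four
distinct conjugates), `η̄ = -η`, `η² = 2s_B³ - 4s_B - 4 ∈ 𝒪_F` — i.e. `(B, η)` is a CM-Weil datum in the normal
form of the tree's `Deligne1982.IsWeilTypeCM B η R₁₂ 2 n` (`E = ℚ[T]/(R₁₂(T²))`, `e₀ = [F:ℚ] = 2`, `2k = dim_K H¹
= h = 2n`, `dim B = 2k e₀ = 4n`), and `R₁₂ = R_(1,3)` is LITERALLY the polynomial `S² + 2d(1+m)S + d²(m-1)²` of the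
biquadratic presentation `K = ℚ(√-d, √m) = ℚ[T]/(R_(d,m)(T²))` at `(d, m) = (1, 3)` (`ℚ(i, √3) = ℚ(ζ₁₂)`). The
endomorphism identities `η² = 2s_B³ - 4s_B - 4` and `P₁₂(η) = η⁴ + 8η² + 4 = 0` are PROVED below in any preadditive
category from `Φ₁₂(s_B) = 0` (certificates `p² - (2x³ - 4x - 4) = (x² + 4x + 5)·Φ₁₂` and `p⁴ + 8p² + 4 =
(x⁸ + 8x⁷ + 25x⁶ + 36x⁵ + 16x⁴ - 20x³ - 27x² + 13)·Φ₁₂`, `p = x³ + 2x² - 1`). TYPING of the conclusion (Moonen–Zarhin,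
as in the rung files of the `K`-ladder): "`U_prim` is generated by algebraic cycles" is "every class of
`weilClassesField B η (R₁₂.comp (X²)) (2n) = ⊕_{P₁₂(ρ)=0} ⋀^{2n} H¹(B)_ρ = U_prim ⊗ ℂ` lies in `algebraicClasses B.X n`"
(the `ℂ`-span of the codimension-`n` cycle classes).

## Placement (NOT verbatim in print — DERIVED-ELEMENTARY, recorded as a separate named statement)

`cyclicPrymTwelve_isHyperbolicWeilTypeCM_allGenera` says that `(B, η)` is of HYPERBOLIC (= split) Weil type
relative to `K`, `IsHyperbolicWeilTypeCM B η R₁₂ 2 n`, i.e. a member of the family over which the biquadratic rung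
`(d, m) = (1, 3)` of the `K`-ladder quantifies. Derivation of record (standard; no printed statement found for
`m = 12` — searched: corpus fts+vec "Prym unramified cyclic cover Weil type isotropic discriminant", galaxy
"trivial discriminant|det H = 1|split Weil type"; in print only `m = 3, 4`: Patel–Zhang §1.3 "trivial
discriminant", van Geemen LNM 1594 7.1 "an explicit computation, using … [Fay], chap. IV, shows that `det H = 1`",
van Geemen 1996 Thm. 5.3 (1)): (i) WEIL TYPE — `dim B = 4n`, and each primitive eigenvalue has multiplicity
`h/2 = n` on `H^{1,0}` (Patel–Zhang §5.1 / Lemma 5.1; Schoen §1 (1.1), §3), so `eigenMultiplicity B η ρ = n` at each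
root `ρ` of `P₁₂`; (ii) POLARIZATION — the restriction `h` to `B` of the canonical principal polarization of
`J(C)` is `⟨α⟩`-invariant, so its Rosati involution is `s_B ↦ s_B⁻¹ = s̄_B`, i.e. complex conjugation on `K`,
`η ↦ η̄ = -η`; (iii) LAGRANGIAN — choose disjoint simple closed curves `a₁, …, a_{n+1}` on `C'` spanning a Lagrangian
of `H₁(C', ℤ)` on which the class `χ ∈ H¹(C', ℤ/12)` of the cover vanishes (lift `χ` to `⟨·, v⟩`, put the primitive
vector under `v` into a symplectic basis as `a₁`); `C' ∖ ⋃ aᵢ` is planar, the cover is trivial over it, and the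
`12(n+1)` lifted curves are pairwise disjoint, so their classes span a `⟨α⟩`-stable ISOTROPIC subspace
`Λ ⊂ H₁(C, ℚ)` of dimension `12(n+1) - 12 + 1 = g(C)` (one relation per sheet, the sum of all relations
vanishing): a `G`-stable Lagrangian, `Λ ≅ 𝟙 ⊕ ℚ[G]ⁿ` as a `G`-module; its primitive part `Λ_prim = e_prim Λ ≅ Kⁿ`
is a `K`-subspace of `H₁(B_prim, ℚ) ≅ K^{2n}` of HALF dimension, isotropic for the restricted alternating form
(`e_prim` is self-adjoint, `G` acting by isometries and the primitive characters being closed under inversion),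
hence totally isotropic for the `K`-hermitian form `ψ` with `E = Tr_{K/ℚ}(ζψ)`: Deligne's condition (b) of
Cor. 4.2, so (a) `disc = (-1)ⁿ` as well; dually (Poincaré) `H¹(B, ℚ)` contains an `η^*`-stable rational
Lagrangian of dimension `4n` for `x ⌣ y ⌣ h^{4n-1}` (`Motives.IsHyperbolicWeilType B η (n·2) h`). Grade of this
statement: DERIVED (elementary surface topology + Chevalley–Weil + Deligne 1982 Cor. 4.2); consumers who want only
refereed input take the algebraicity fact alone (it needs no placement).

## Faithfulness sheet (per declaration)

* `Schoen1988_cyclicPrym_weilClasses_algebraic_degreeTwelve_allGenera` — FAITHFUL (= Schoen Cor. 3.1 with Thm. 2.0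
  at `(q, m, r) = (n+1, 12, 0)`, all `n ≥ 1` = Patel–Zhang Thm. 5.3 at `G = ℤ/12`, all `g(C') ≥ 2`; the Weil space
  rendered through the generator `η = -1 + 2ζ₁₂² + ζ₁₂³` of `K`, see RENDERING); REFEREED. WEAKER than print only in
  fixing `m`.
* `cyclicPrymTwelve_isHyperbolicWeilTypeCM_allGenera` — DERIVED-ELEMENTARY placement (above); NOT a printed theorem.
* `comp_pow_four_eq_of_cyclotomic₁₂`, `weilGenerator_comp_self_of_cyclotomic₁₂`,
  `weilGenerator_quartic_of_cyclotomic₁₂`, `kerComponent_cyclotomic₁₂_restrict_eq_zero`,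
  `kerComponent_weilGenerator_quartic_of_cyclotomic₁₂`, `eval₂_weilQuartic_End`,
  `kerComponent_eval₂_weilGenerator_eq_zero`, `pushforward_comp_pow_twelve_of_pow_twelve` — THEOREMS (dictionary, proved here; arithmetic of `ℤ[ζ₁₂] ⊂ End B`, Schoen §3 p. 24).
* `weilClassesField_cyclicPrymTwelvefold_algebraic_of_schoen1988` — THEOREM (consistency at `n = 3`: `g(C') = 4`,
  `g(C) = 37`, `B` a TWELVEFOLD, `U_prim ⊗ ℂ ⊂ H⁶`, codimension-`3` cycles — the `(d, m) = (1, 3)` biquadratic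
  every-member statement RESTRICTED to the `ℤ/12`-Prym locus holds, granted the refereed fact; the hyperbolicity,
  rationality and Hodge-type hypotheses are not used).
* `isHyperbolicWeilTypeCM_cyclicPrymTwelvefold_of_placement` — THEOREM (the placement at `n = 3`).

## References

* [Schoen1988HodgeWeil] C. Schoen, Compositio Math. 65 (1988) 3–32: Thm. 2.0 (p. 11), p. 12, §3 Cor. 3.1 (p. 24),
  pp. 25–26 (moduli count `(φ(m)/2)(h/2)²` versus `3q - 3 + 2r`).
* [PatelZhang2025PrymHodge] D. Patel, Y. Zhang, arXiv:2506.13729 = J. Algebra 712 (2027): Thm. 1.2, §1.3, §5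
  Lemma 5.1, Def. 5.2, Thm. 5.3.
* [MoonenZarhin1998WeilClasses] B. Moonen, Yu. Zarhin, J. reine angew. Math. 496 (1998): §1 (`W_F ⊗ ℂ = ⊕_σ ⋀ʳ V_{ℂ,σ}`).
* [Deligne1982HodgeCycles] P. Deligne (notes by J. Milne), LNM 900 (1982): §4 (4.4), Cor. 4.2, Prop. 4.4.
* [vanGeemen1994HodgeAV] B. van Geemen, LNM 1594 (1994): 4.9, Lemma 5.2, 5.4, 7.1–7.4.
* [vanGeemen1996ThetaFourfolds] B. van Geemen, Math. Z. 221 (1996): Thm. 5.3 (the `m = 4` placement).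
-/

noncomputable section

open CategoryTheory

namespace Literature.AlgebraicGeometry.HodgeTheory

open Literature.AlgebraicGeometry Literature.AlgebraicGeometry.Motives
open Literature.AlgebraicTopology.SingularHomology

/-! ### The `m = 12` slice of Schoen's cyclic theorem (named facts) -/

/-- **Schoen's cyclic theorem, degree `12`, ALL genera: the primitive Prym `4n`-fold of `ℚ(ζ₁₂)`-Weil type
(Schoen 1988, Thm. 2.0 + Cor. 3.1 at `(q, m, r) = (n + 1, 12, 0)`, every `n ≥ 1` = Patel–Zhang, Thm. 1.2 /
Thm. 5.3 with Lemma 5.1 and §5.1 at `G = ℤ/12`, every `g(C') ≥ 2`), on the tree's carriers.** PRINTED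
STATEMENT: for an étale cyclic cover `C → C'` of degree `12` of smooth projective complex curves with
`g(C') ≥ 2`, `h := 2g(C') - 2`, Schoen's primitive Prym `B_prim = J(C)_{V_prim} ⊂ J(C)` (the abelian subvariety
on which `ℤ/12` acts through the primitive twelfth roots of unity) has `H¹(B_prim, ℚ)` a `ℚ(μ₁₂)`-vector space of
dimension `h`, each primitive character of multiplicity `h/2` on `T₀B_prim` (§5.1), and
`U_prim := ⋀^h_{ℚ(μ₁₂)} H¹(B_prim, ℚ)` "is generated by algebraic cycles" (Thm. 5.3 "(Schoen88)" = Schoen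
Cor. 3.1, p. 24, with Thm. 2.0, `r = 0`). No genericity hypothesis, no restriction on the genus. RENDERING (module
docstring): `g(C') = n + 1`, `g(C) = 12n + 1`, `α¹² = 𝟙` with `α⁴`, `α⁶` fixed-point free, `s = α_*`,
`Φ = 𝟙 - s² + s⁴ = Φ₁₂(s)`, `B = (ker Φ)⁰ = B_prim` (a `4n`-fold), `s_B` the restriction of `s`, Weil generator
`η = -𝟙 + 2s_B² + s_B³` (`= i(1+√3)` on the `ζ₁₂`-eigenlines; `η⁴ + 8η² + 4 = 0`,
`kerComponent_weilGenerator_quartic_of_cyclotomic₁₂`); conclusion: every class of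
`weilClassesField B η ((X² + 8X + 4).comp (X²)) (2n) = ⊕_ρ ⋀^{2n} H¹(B)_ρ = U_prim ⊗ ℂ` lies in
`algebraicClasses B.X n`. Grade: REFEREED (both sources). Faithfulness: FAITHFUL (the `m = 12` slice of the
printed all-`(m, q)` theorem). Users take `(h : Schoen1988_cyclicPrym_weilClasses_algebraic_degreeTwelve_allGenera)`.
[cite: Schoen1988HodgeWeil, Thm 2.0 (p. 11), p. 12, and Cor 3.1 (p. 24), at (q, m, r) = (n+1, 12, 0)]
[cite: PatelZhang2025PrymHodge, Thm 1.2, Lemma 5.1, §5.1 (Def. 5.2) and Thm 5.3]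
[cite: MoonenZarhin1998WeilClasses, §1 (W_F ⊗ ℂ = ⊕_σ ⋀^r V_{ℂ,σ})] -/
def Schoen1988_cyclicPrym_weilClasses_algebraic_degreeTwelve_allGenera : Prop :=
  ∀ (n : ℕ), 1 ≤ n → ∀ (C : SchemeOver ℂ) (𝒥 : Jacobian C) (α : C ⟶ C),
    IsSmoothProjective 1 C → 𝒥.J.dim = 12 * n + 1 →
    α ≫ α ≫ α ≫ α ≫ α ≫ α ≫ α ≫ α ≫ α ≫ α ≫ α ≫ α = 𝟙 C →
    (∀ P : ComplexPoints C, P ≫ (α ≫ α ≫ α ≫ α) ≠ P ∧ P ≫ (α ≫ α ≫ α ≫ α ≫ α ≫ α) ≠ P) →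
  ∀ (s Φ : 𝒥.J ⟶ 𝒥.J), s = 𝒥.pushforward 𝒥 α → Φ = 𝟙 𝒥.J - s ≫ s + s ≫ s ≫ s ≫ s →
  ∀ (sB η : AbelianVariety.kerComponent Φ ⟶ AbelianVariety.kerComponent Φ),
    sB ≫ AbelianVariety.kerComponentι Φ = AbelianVariety.kerComponentι Φ ≫ s →
    η = -𝟙 _ + 2 • (sB ≫ sB) + sB ≫ sB ≫ sB →
  ∀ c ∈ weilClassesField (AbelianVariety.kerComponent Φ) η
      ((Polynomial.X ^ 2 + Polynomial.C (8 : ℤ) * Polynomial.X + Polynomial.C (4 : ℤ)).comp (Polynomial.X ^ 2)) (2 * n),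
    c ∈ algebraicClasses (AbelianVariety.kerComponent Φ).X n

/-- **PLACEMENT of the `m = 12` locus (DERIVED-ELEMENTARY, module docstring § Placement; NOT a printed theorem):
the primitive Prym `(B, η)` of an étale cyclic cover of degree `12` of a genus-`(n+1)` curve is of HYPERBOLIC
(split) Weil type relative to the CM field `K = ℚ(η) = ℚ(ζ₁₂) ≅ ℚ[T]/(R₁₂(T²))`, `R₁₂ = S² + 8S + 4`, with
`e₀ = [ℚ(√3):ℚ] = 2` and `E`-rank `2k = 2n`** — `IsHyperbolicWeilTypeCM B η R₁₂ 2 n`: Weil type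
(Chevalley–Weil multiplicities `h/2 = n`, Patel–Zhang §5.1), a polarization class with Rosati involution complex
conjugation on `K` (the restricted principal polarization of `J(C)`), split discriminant AND an `η^*`-stable
rational Lagrangian (the primitive part of the Lagrangian spanned by the lifts of the `a`-curves; Deligne 1982
Cor. 4.2 (b) ⟹ (a)). In print only for `m = 3, 4` ("trivial discriminant", Patel–Zhang §1.3; van Geemen 1996
Thm. 5.3 (1) "`det H = 1`"); recorded here as the statement placing the `ℤ/12`-Prym locus INSIDE the family of the
biquadratic cell `(d, m) = (1, 3)` of the tree's `K`-ladder. Users take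
`(h : cyclicPrymTwelve_isHyperbolicWeilTypeCM_allGenera)`.
[cite: PatelZhang2025PrymHodge, Lemma 5.1 and §5.1] [cite: Deligne1982HodgeCycles, §4 Cor. 4.2 and Prop. 4.4]
[cite: vanGeemen1994HodgeAV, Lemma 5.2, 5.4 and 7.1] [cite: vanGeemen1996ThetaFourfolds, Thm. 5.3 (1)] -/
def cyclicPrymTwelve_isHyperbolicWeilTypeCM_allGenera : Prop :=
  ∀ (n : ℕ), 1 ≤ n → ∀ (C : SchemeOver ℂ) (𝒥 : Jacobian C) (α : C ⟶ C),
    IsSmoothProjective 1 C → 𝒥.J.dim = 12 * n + 1 →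
    α ≫ α ≫ α ≫ α ≫ α ≫ α ≫ α ≫ α ≫ α ≫ α ≫ α ≫ α = 𝟙 C →
    (∀ P : ComplexPoints C, P ≫ (α ≫ α ≫ α ≫ α) ≠ P ∧ P ≫ (α ≫ α ≫ α ≫ α ≫ α ≫ α) ≠ P) →
  ∀ (s Φ : 𝒥.J ⟶ 𝒥.J), s = 𝒥.pushforward 𝒥 α → Φ = 𝟙 𝒥.J - s ≫ s + s ≫ s ≫ s ≫ s →
  ∀ (sB η : AbelianVariety.kerComponent Φ ⟶ AbelianVariety.kerComponent Φ),
    sB ≫ AbelianVariety.kerComponentι Φ = AbelianVariety.kerComponentι Φ ≫ s →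
    η = -𝟙 _ + 2 • (sB ≫ sB) + sB ≫ sB ≫ sB →
  IsHyperbolicWeilTypeCM (AbelianVariety.kerComponent Φ) η
    (Polynomial.X ^ 2 + Polynomial.C (8 : ℤ) * Polynomial.X + Polynomial.C (4 : ℤ)) 2 n

/-! ### Dictionary: `Φ₁₂(t) = 0` ⟹ `η = -1 + 2t² + t³` satisfies `η² = 2t³ - 4t - 4` and `η⁴ + 8η² + 4 = 0`

Proved in any preadditive category (the commutative subring `ℤ[t] ⊂ End X` being a quotient of
`ℤ[x]/(Φ₁₂) = ℤ[ζ₁₂]`): the certificates are `p² - (2x³ - 4x - 4) = (x² + 4x + 5)·Φ₁₂(x)` and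
`p⁴ + 8p² + 4 = (x⁸ + 8x⁷ + 25x⁶ + 36x⁵ + 16x⁴ - 20x³ - 27x² + 13)·Φ₁₂(x)` for `p = x³ + 2x² - 1`; the proofs
below just reduce powers `t^k`, `k ≥ 4`, with `t⁴ = t² - 1` and compare coefficients. -/

section CyclotomicTwelve

variable {𝒞 : Type*} [Category 𝒞] [Preadditive 𝒞] {X : 𝒞} {t : X ⟶ X}

/-- If `Φ₁₂(t) = 1 - t² + t⁴ = 0` then `t⁴ = t² - 1` (arithmetic of the order `ℤ[t]/(Φ₁₂) = ℤ[ζ₁₂]`, the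
"correct sort of multiplication from `K`" on Schoen's `B`, §3 p. 24; Patel–Zhang §5.1
"`End_ℚ(B_prim) ⊇ ℚ(μ_m)`"). [cite: Schoen1988HodgeWeil, §3 (p. 24)] [cite: PatelZhang2025PrymHodge, §5.1] -/
theorem comp_pow_four_eq_of_cyclotomic₁₂ (h : 𝟙 X - t ≫ t + t ≫ t ≫ t ≫ t = 0) :
    t ≫ t ≫ t ≫ t = t ≫ t - 𝟙 X := by
  rw [← sub_eq_zero, ← h]
  abel

/-- Reassociated form of `t⁴ = t² - 1`: `t⁴ ≫ f = t² ≫ f - f`.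
[cite: Schoen1988HodgeWeil, §3 (p. 24)] [cite: PatelZhang2025PrymHodge, §5.1] -/
theorem comp_pow_four_comp_eq_of_cyclotomic₁₂ (h : 𝟙 X - t ≫ t + t ≫ t ≫ t ≫ t = 0) {Y : 𝒞} (f : X ⟶ Y) :
    t ≫ t ≫ t ≫ t ≫ f = t ≫ t ≫ f - f := by
  calc t ≫ t ≫ t ≫ t ≫ f = (t ≫ t ≫ t ≫ t) ≫ f := by simp only [Category.assoc]
    _ = t ≫ t ≫ f - f := by
      rw [comp_pow_four_eq_of_cyclotomic₁₂ h, Preadditive.sub_comp, Category.id_comp, Category.assoc]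

/-- **`η² = 2t³ - 4t - 4 ∈ ℤ[t + t⁻¹]`** for `η = -1 + 2t² + t³`, `Φ₁₂(t) = 0` (on a `ζ₁₂`-eigenline:
`η² = -(1 + √3)² = -4 - 2√3`; the real quadratic subring `ℤ[2t³ - 4t] ⊂ ℤ[t + t⁻¹]·ℤ[ζ₁₂]` of
`F = ℚ(√3)`). [cite: Schoen1988HodgeWeil, §3 (p. 24)] [cite: PatelZhang2025PrymHodge, §5.1]
[cite: vanGeemen1994HodgeAV, 5.2] -/
theorem weilGenerator_comp_self_of_cyclotomic₁₂ (h : 𝟙 X - t ≫ t + t ≫ t ≫ t ≫ t = 0) {η : X ⟶ X}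
    (hη : η = -𝟙 X + 2 • (t ≫ t) + t ≫ t ≫ t) :
    η ≫ η = 2 • (t ≫ t ≫ t) - 4 • t - 4 • 𝟙 X := by
  have h4 := comp_pow_four_eq_of_cyclotomic₁₂ h
  subst hη
  simp only [Preadditive.add_comp, Preadditive.comp_add, Preadditive.neg_comp, Preadditive.comp_neg,
    Preadditive.nsmul_comp, Preadditive.comp_nsmul, Preadditive.comp_sub,
    Category.id_comp, Category.comp_id, Category.assoc, h4, smul_sub]
  abel

/-- **`P₁₂(η) = η⁴ + 8η² + 4 = 0`** for `η = -1 + 2t² + t³`, `Φ₁₂(t) = 0`: `η` is a root of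
`R₁₂(T²) = T⁴ + 8T² + 4`, the presentation `ℚ[T]/(R_(1,3)(T²))` of `ℚ(i, √3) = ℚ(ζ₁₂)`.
[cite: Schoen1988HodgeWeil, §3 (p. 24)] [cite: PatelZhang2025PrymHodge, §5.1] [cite: vanGeemen1994HodgeAV, 5.2] -/
theorem weilGenerator_quartic_of_cyclotomic₁₂ (h : 𝟙 X - t ≫ t + t ≫ t ≫ t ≫ t = 0) {η : X ⟶ X}
    (hη : η = -𝟙 X + 2 • (t ≫ t) + t ≫ t ≫ t) :
    η ≫ η ≫ η ≫ η + 8 • (η ≫ η) + 4 • 𝟙 X = 0 := by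
  have h2 := weilGenerator_comp_self_of_cyclotomic₁₂ h hη
  have h4 := comp_pow_four_eq_of_cyclotomic₁₂ h
  have hsq : η ≫ η ≫ η ≫ η = (η ≫ η) ≫ (η ≫ η) := by simp only [Category.assoc]
  rw [hsq, h2]
  simp only [Preadditive.nsmul_comp, Preadditive.comp_nsmul, Preadditive.sub_comp, Preadditive.comp_sub,
    Category.id_comp, Category.comp_id, Category.assoc, h4, smul_sub]
  abel

/-- In `End X` (composition ring of a preadditive category), `P(η)` for `P = (X² + 8X + 4)∘(X²) = X⁴ + 8X² + 4`
is `η⁴ + 8η² + 4·𝟙` — the `eval₂` form used by `Deligne1982.IsWeilTypeCM.eval₂_eq_zero` and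
`HodgeTheory.weilClassesField` (cf. `Deligne1982.eval₂_X_sq_add_C_End`, the quadratic case).
[cite: vanGeemen1994HodgeAV, 4.9 and 5.2] [cite: MoonenZarhin1998WeilClasses, §1 (6)] -/
theorem eval₂_weilQuartic_End (η : X ⟶ X) :
    Polynomial.eval₂ (Int.castRingHom (CategoryTheory.End X)) (CategoryTheory.End.of η)
      ((Polynomial.X ^ 2 + Polynomial.C (8 : ℤ) * Polynomial.X + Polynomial.C (4 : ℤ)).comp (Polynomial.X ^ 2)) =
      CategoryTheory.End.of (η ≫ η ≫ η ≫ η + 8 • (η ≫ η) + 4 • 𝟙 X) := by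
  have hP : (Polynomial.X ^ 2 + Polynomial.C (8 : ℤ) * Polynomial.X + Polynomial.C (4 : ℤ)).comp
      (Polynomial.X ^ 2) = (Polynomial.X ^ 4 + Polynomial.C (8 : ℤ) * Polynomial.X ^ 2 + Polynomial.C (4 : ℤ) :
        Polynomial ℤ) := by
    simp only [Polynomial.add_comp, Polynomial.mul_comp, Polynomial.pow_comp, Polynomial.X_comp,
      Polynomial.C_comp]
    ring
  rw [hP, Polynomial.C_mul_X_pow_eq_monomial, Polynomial.eval₂_add, Polynomial.eval₂_add,
    Polynomial.eval₂_X_pow, Polynomial.eval₂_monomial, Polynomial.eval₂_C, eq_intCast, eq_intCast,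
    Int.cast_ofNat, Int.cast_ofNat]
  have h2 : CategoryTheory.End.of η ^ 2 = CategoryTheory.End.of (η ≫ η) := by
    rw [pow_two, End.mul_def]
  have h4 : CategoryTheory.End.of η ^ 4 = CategoryTheory.End.of (η ≫ η ≫ η ≫ η) := by
    rw [show (4 : ℕ) = 2 + 2 from rfl, pow_add, h2, End.mul_def]
    exact Category.assoc _ _ _
  rw [h4, h2, ← Nat.cast_ofNat (R := CategoryTheory.End X) (n := 8), ← nsmul_eq_mul,
    ← Nat.cast_ofNat (R := CategoryTheory.End X) (n := 4), ← nsmul_one, End.one_def]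
  rfl

/-- **`P₁₂(η) = 0` in `End X`, `eval₂` form.** [cite: Schoen1988HodgeWeil, §3 (p. 24)]
[cite: vanGeemen1994HodgeAV, 4.9 and 5.2] -/
theorem eval₂_weilQuartic_End_eq_zero_of_cyclotomic₁₂ (h : 𝟙 X - t ≫ t + t ≫ t ≫ t ≫ t = 0) {η : X ⟶ X}
    (hη : η = -𝟙 X + 2 • (t ≫ t) + t ≫ t ≫ t) :
    Polynomial.eval₂ (Int.castRingHom (CategoryTheory.End X)) (CategoryTheory.End.of η)
      ((Polynomial.X ^ 2 + Polynomial.C (8 : ℤ) * Polynomial.X + Polynomial.C (4 : ℤ)).comp (Polynomial.X ^ 2)) =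
      0 := by
  rw [eval₂_weilQuartic_End, weilGenerator_quartic_of_cyclotomic₁₂ h hη]
  rfl

end CyclotomicTwelve

/-! ### On the primitive Prym `B = (ker Φ₁₂(s))⁰` -/

section PrimitivePrym

variable {J : AbelianVariety ℂ} {s Φ : J ⟶ J}

/-- **`Φ₁₂(s_B) = 0` on `B = (ker Φ₁₂(s))⁰`**: the restriction `s_B` of `s` to the identity component of
`ker (𝟙 - s² + s⁴)` is killed by `Φ₁₂` (`ι ≫ Φ₁₂(s) = 0`, `AbelianVariety.kerComponentι_comp`, `ι` mono), so `s_B`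
acts on every realisation of `B` through primitive twelfth roots of unity — `B` is Schoen's `B_prim`
(Patel–Zhang Def. 5.2). [cite: Schoen1988HodgeWeil, §3 (p. 24)] [cite: PatelZhang2025PrymHodge, §5.1 Def. 5.2] -/
theorem kerComponent_cyclotomic₁₂_restrict_eq_zero (hΦ : Φ = 𝟙 J - s ≫ s + s ≫ s ≫ s ≫ s)
    {sB : AbelianVariety.kerComponent Φ ⟶ AbelianVariety.kerComponent Φ}
    (hsB : sB ≫ AbelianVariety.kerComponentι Φ = AbelianVariety.kerComponentι Φ ≫ s) :
    𝟙 _ - sB ≫ sB + sB ≫ sB ≫ sB ≫ sB = 0 := by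
  have hι : AbelianVariety.kerComponentι Φ ≫ (𝟙 J - s ≫ s + s ≫ s ≫ s ≫ s) = 0 := by
    rw [← hΦ]; exact AbelianVariety.kerComponentι_comp Φ
  have h2 : (sB ≫ sB) ≫ AbelianVariety.kerComponentι Φ = AbelianVariety.kerComponentι Φ ≫ s ≫ s := by
    rw [Category.assoc, hsB, ← Category.assoc, hsB, Category.assoc]
  have h4 : (sB ≫ sB ≫ sB ≫ sB) ≫ AbelianVariety.kerComponentι Φ =
      AbelianVariety.kerComponentι Φ ≫ s ≫ s ≫ s ≫ s := by
    have e : sB ≫ sB ≫ sB ≫ sB = (sB ≫ sB) ≫ (sB ≫ sB) := by simp only [Category.assoc]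
    rw [e, Category.assoc, h2, ← Category.assoc, h2, Category.assoc, Category.assoc]
  rw [← cancel_mono (AbelianVariety.kerComponentι Φ), Limits.zero_comp, ← hι, Preadditive.add_comp,
    Preadditive.sub_comp, Category.id_comp, h2, h4, Preadditive.comp_add, Preadditive.comp_sub,
    Category.comp_id]

/-- **`η⁴ + 8η² + 4 = 0` on `B = (ker Φ₁₂(s))⁰`** for the Weil generator `η = -𝟙 + 2s_B² + s_B³`, in the binder
shape of `Schoen1988_cyclicPrym_weilClasses_algebraic_degreeTwelve_allGenera`: `B` carries multiplication by the
order `ℤ[η] ⊂ ℤ[ζ₁₂]` of `K = ℚ(ζ₁₂) = ℚ(i, √3)`, `η ↦ i(1 + √3)`. [cite: Schoen1988HodgeWeil, §3 (p. 24)] -/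
theorem kerComponent_weilGenerator_quartic_of_cyclotomic₁₂ (hΦ : Φ = 𝟙 J - s ≫ s + s ≫ s ≫ s ≫ s)
    {sB η : AbelianVariety.kerComponent Φ ⟶ AbelianVariety.kerComponent Φ}
    (hsB : sB ≫ AbelianVariety.kerComponentι Φ = AbelianVariety.kerComponentι Φ ≫ s)
    (hη : η = -𝟙 _ + 2 • (sB ≫ sB) + sB ≫ sB ≫ sB) :
    η ≫ η ≫ η ≫ η + 8 • (η ≫ η) + 4 • 𝟙 _ = 0 :=
  weilGenerator_quartic_of_cyclotomic₁₂ (kerComponent_cyclotomic₁₂_restrict_eq_zero hΦ hsB) hη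

/-- **`P₁₂(η) = 0` in `End B`** (`eval₂` form: the field `Deligne1982.IsWeilTypeCM.eval₂_eq_zero` of the CM-Weil
datum `(B, η, R₁₂ = S² + 8S + 4, e₀ = 2, k = n)`). [cite: Schoen1988HodgeWeil, §3 (p. 24)]
[cite: Deligne1982HodgeCycles, §4 (4.4)] -/
theorem kerComponent_eval₂_weilGenerator_eq_zero (hΦ : Φ = 𝟙 J - s ≫ s + s ≫ s ≫ s ≫ s)
    {sB η : AbelianVariety.kerComponent Φ ⟶ AbelianVariety.kerComponent Φ}
    (hsB : sB ≫ AbelianVariety.kerComponentι Φ = AbelianVariety.kerComponentι Φ ≫ s)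
    (hη : η = -𝟙 _ + 2 • (sB ≫ sB) + sB ≫ sB ≫ sB) :
    Polynomial.eval₂ (Int.castRingHom (CategoryTheory.End (AbelianVariety.kerComponent Φ)))
      (CategoryTheory.End.of η)
      ((Polynomial.X ^ 2 + Polynomial.C (8 : ℤ) * Polynomial.X + Polynomial.C (4 : ℤ)).comp (Polynomial.X ^ 2)) = 0 :=
  eval₂_weilQuartic_End_eq_zero_of_cyclotomic₁₂ (kerComponent_cyclotomic₁₂_restrict_eq_zero hΦ hsB) hη

/-- **`(α_*)¹² = 𝟙_{J(C)}` for `α¹² = 𝟙_C`** (Albanese functoriality, `Jacobian.pushforward_comp`,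
`Jacobian.pushforward_id`). [cite: Lange2023AbelianVarietiesC, §4.5.2] -/
theorem pushforward_comp_pow_twelve_of_pow_twelve {C : SchemeOver ℂ} (𝒥 : Jacobian C) {α : C ⟶ C}
    (hα : α ≫ α ≫ α ≫ α ≫ α ≫ α ≫ α ≫ α ≫ α ≫ α ≫ α ≫ α = 𝟙 C) {s : 𝒥.J ⟶ 𝒥.J}
    (hs : s = 𝒥.pushforward 𝒥 α) :
    s ≫ s ≫ s ≫ s ≫ s ≫ s ≫ s ≫ s ≫ s ≫ s ≫ s ≫ s = 𝟙 𝒥.J := by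
  subst hs
  simp only [← Jacobian.pushforward_comp, hα, Jacobian.pushforward_id]

end PrimitivePrym

/-! ### Consistency: the biquadratic `(d, m) = (1, 3)` every-member statement holds ON THE `ℤ/12`-PRYM LOCUS -/

/-- **The `ℚ(ζ₁₂)`-Weil twelvefold rung at the Prym anchor (granted Schoen's refereed theorem).** For the genus-`4`
member `(B, η)` (the binders of `…_degreeTwelve_allGenera` at `n = 3`: `dim J(C) = 37`, `B` a twelvefold): every RATIONAL class of Hodge type `(3,3)` in the
complexified `K`-Weil space `weilClassesField B η (R₁₂.comp (X²)) 6 = U_prim ⊗ ℂ`, `R₁₂ = S² + 8S + 4`, is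
algebraic — indeed EVERY class of that space is, by the fact, so neither the rationality, nor the Hodge type, nor
the hyperbolicity hypothesis `IsHyperbolicWeilTypeCM B η R₁₂ 2 3` is used. This is, binder for binder, the body
of the `(d, m) = (1, 3)` cell of the biquadratic `K`-ladder statement «every hyperbolic `(B, η)` with
`IsHyperbolicWeilTypeCM B η R_(d,m) 2 3` has its rational `(3,3)` `K`-Weil classes algebraic» RESTRICTED to the
`9`-dimensional `ℤ/12`-Prym locus of the `18`-dimensional family (Schoen pp. 25–26) — a decided sub-case, not the
cell. [cite: Schoen1988HodgeWeil, Cor 3.1 (p. 24) and pp. 25–26] [cite: PatelZhang2025PrymHodge, Thm 5.3] -/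
theorem weilClassesField_cyclicPrymTwelvefold_algebraic_of_schoen1988
    (hS : Schoen1988_cyclicPrym_weilClasses_algebraic_degreeTwelve_allGenera)
    (C : SchemeOver ℂ) (𝒥 : Jacobian C) (α : C ⟶ C) (hC : IsSmoothProjective 1 C) (hdim : 𝒥.J.dim = 37)
    (hα : α ≫ α ≫ α ≫ α ≫ α ≫ α ≫ α ≫ α ≫ α ≫ α ≫ α ≫ α = 𝟙 C)
    (hfree : ∀ P : ComplexPoints C, P ≫ (α ≫ α ≫ α ≫ α) ≠ P ∧ P ≫ (α ≫ α ≫ α ≫ α ≫ α ≫ α) ≠ P)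
    (s Φ : 𝒥.J ⟶ 𝒥.J) (hs : s = 𝒥.pushforward 𝒥 α) (hΦ : Φ = 𝟙 𝒥.J - s ≫ s + s ≫ s ≫ s ≫ s)
    (sB η : AbelianVariety.kerComponent Φ ⟶ AbelianVariety.kerComponent Φ)
    (hsB : sB ≫ AbelianVariety.kerComponentι Φ = AbelianVariety.kerComponentι Φ ≫ s)
    (hη : η = -𝟙 _ + 2 • (sB ≫ sB) + sB ≫ sB ≫ sB)
    (_hH : IsHyperbolicWeilTypeCM (AbelianVariety.kerComponent Φ) η
      (Polynomial.X ^ 2 + Polynomial.C (8 : ℤ) * Polynomial.X + Polynomial.C (4 : ℤ)) 2 3)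
    (c : complexBetti (AbelianVariety.kerComponent Φ).X 6)
    (hc : c ∈ weilClassesField (AbelianVariety.kerComponent Φ) η
      ((Polynomial.X ^ 2 + Polynomial.C (8 : ℤ) * Polynomial.X + Polynomial.C (4 : ℤ)).comp (Polynomial.X ^ 2)) 6)
    (_hcQ : IsRationalClass c)
    (_h33 : IsOfHodgeType (AbelianVariety.kerComponent Φ).dim (AbelianVariety.kerComponent Φ).X 6 3 3 c) :
    c ∈ algebraicClasses (AbelianVariety.kerComponent Φ).X 3 :=
  hS 3 (by norm_num) C 𝒥 α hC (hdim.trans (by norm_num)) hα hfree s Φ hs hΦ sB η hsB hη c hc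

/-- **Membership (granted the placement statement): the genus-`4` `ℤ/12`-Prym `(B, η)` lies in the family of the
biquadratic cell `(d, m) = (1, 3)`** — `IsHyperbolicWeilTypeCM B η R₁₂ 2 3`, `R₁₂ = R_(1,3) = S² + 8S + 4` —, so the
restriction above is to a NON-EMPTY part of the cell's domain whenever an étale `ℤ/12`-cover of a genus-`4` curve is
given. [cite: PatelZhang2025PrymHodge, Lemma 5.1 and §5.1] [cite: Deligne1982HodgeCycles, §4 Cor. 4.2] -/
theorem isHyperbolicWeilTypeCM_cyclicPrymTwelvefold_of_placement
    (hP : cyclicPrymTwelve_isHyperbolicWeilTypeCM_allGenera)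
    (C : SchemeOver ℂ) (𝒥 : Jacobian C) (α : C ⟶ C) (hC : IsSmoothProjective 1 C) (hdim : 𝒥.J.dim = 37)
    (hα : α ≫ α ≫ α ≫ α ≫ α ≫ α ≫ α ≫ α ≫ α ≫ α ≫ α ≫ α = 𝟙 C)
    (hfree : ∀ P : ComplexPoints C, P ≫ (α ≫ α ≫ α ≫ α) ≠ P ∧ P ≫ (α ≫ α ≫ α ≫ α ≫ α ≫ α) ≠ P)
    (s Φ : 𝒥.J ⟶ 𝒥.J) (hs : s = 𝒥.pushforward 𝒥 α) (hΦ : Φ = 𝟙 𝒥.J - s ≫ s + s ≫ s ≫ s ≫ s)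
    (sB η : AbelianVariety.kerComponent Φ ⟶ AbelianVariety.kerComponent Φ)
    (hsB : sB ≫ AbelianVariety.kerComponentι Φ = AbelianVariety.kerComponentι Φ ≫ s)
    (hη : η = -𝟙 _ + 2 • (sB ≫ sB) + sB ≫ sB ≫ sB) :
    IsHyperbolicWeilTypeCM (AbelianVariety.kerComponent Φ) η
      (Polynomial.X ^ 2 + Polynomial.C (8 : ℤ) * Polynomial.X + Polynomial.C (4 : ℤ)) 2 3 :=
  hP 3 (by norm_num) C 𝒥 α hC (hdim.trans (by norm_num)) hα hfree s Φ hs hΦ sB η hsB hη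

end Literature.AlgebraicGeometry.HodgeTheory
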